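import Summits.Ventures.PercRepro.ConditionalNeg

/-!
# The pendant concavity inequality (5a): Harris after revealing the cluster of `v`

Four marks `v i j k` of a multigraph.  Write `J = {j ↔ k}` and
`D = {v is joined to j or k} ∩ {i is joined to j or k}` (`attachEvent`), both increasing, and
`F = {the cluster of v contains i and avoids j and k}` (`pairEvent`).  Then

* `D ∩ J` is the cell `⊤ = vijk` (all four marks connected) and `D ∩ Jᶜ` is the union `Y` of the
  four cells `vik|j, vij|k, vj|ik, vk|ij` (two blocks, `j` and `k` separated);
* `F ∩ J` is the crossing cell `vi|jk` (mass `x_i`) and `F ∩ Jᶜ` the cell `vi|j|k` (mass `R_i`).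

The results (notation of `proofs/LEAD-C011-concavity.md` §10 and `proofs/P1-lemma7.md`):

* `prob_pairEvent_inter_connEvent_le` (Lemma N): `P(F ∩ J) ≤ P(F) · P(J)` — the tower property
  given the cluster of `v` (`expect_clusterFun_mul_indicator`) and the monotonicity
  `P_{H − C}(j ↔ k) ≤ P_H(j ↔ k)`.
* `harris_cells` (Lemma 7₀): `P(J) · P(Y) ≤ P(Jᶜ) · P(⊤)` — Harris for `D` and `J`.
* `lemma7_of_le` (Lemma 7): for every `p' ≤ p` (e.g. `p` switched off at a vertex set `C`) and
  `q = P_{p'}(J)`: `q · P(Y) ≤ (1 − q) · P(⊤)`.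
* `pendant_lemma6` (Lemma 6, pendant form): `x_i · P(Y) ≤ R_i · P(⊤)`.
* `pendant_5a_sum`: the three instances summed, which dominates the 4-mark inequality (5a),
  i.e. the concavity of `Φ⁺` along a pendant mark-edge.
-/

namespace PercRepro

open Finset

namespace MultiGraph

variable {V E : Type*} (G : MultiGraph V E)

/-- `D`: each of `v` and `i` is joined to `j` or to `k`. -/
def attachEvent (v i j k : V) : Set (Config E) :=
  (G.connEvent v j ∪ G.connEvent v k) ∩ (G.connEvent i j ∪ G.connEvent i k)

/-- `F`: the cluster of `v` contains `i` and avoids `j` and `k`. -/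
def pairEvent (v i j k : V) : Set (Config E) :=
  G.connEvent v i ∩ G.sepEvent v j ∩ G.sepEvent v k

/-- `⊤`: the four marks `v i j k` are all connected (to `v`).  (Named `pendantTopEvent` — the name
`topEvent` is taken by `C005.lean`'s four-mark cell.) -/
def pendantTopEvent (v i j k : V) : Set (Config E) :=
  G.connEvent v i ∩ G.connEvent v j ∩ G.connEvent v k

/-- `D` is increasing. -/
theorem isUpperSet_attachEvent (v i j k : V) : IsUpperSet (G.attachEvent v i j k) :=
  ((G.isUpperSet_connEvent v j).union (G.isUpperSet_connEvent v k)).inter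
    ((G.isUpperSet_connEvent i j).union (G.isUpperSet_connEvent i k))

/-- Membership in `F` in terms of the cluster of `v`. -/
theorem mem_pairEvent_iff (v i j k : V) (ω : Config E) :
    ω ∈ G.pairEvent v i j k ↔
      i ∈ G.cluster ω v ∧ j ∉ G.cluster ω v ∧ k ∉ G.cluster ω v := by
  simp only [pairEvent, Set.mem_inter_iff, connEvent, sepEvent, Set.mem_compl_iff,
    Set.mem_setOf_eq, cluster]
  tauto

/-- On `{j ↔ k}`, `D` is the top cell: `D ∩ J = ⊤`. -/
theorem attachEvent_inter_connEvent (v i j k : V) :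
    G.attachEvent v i j k ∩ G.connEvent j k = G.pendantTopEvent v i j k := by
  ext ω
  simp only [attachEvent, pendantTopEvent, connEvent, Set.mem_inter_iff, Set.mem_union,
    Set.mem_setOf_eq]
  constructor
  · rintro ⟨⟨hv, hi⟩, hjk⟩
    have hvj : G.Conn ω v j := hv.elim id fun h => h.trans hjk.symm
    have hij : G.Conn ω i j := hi.elim id fun h => h.trans hjk.symm
    exact ⟨⟨hvj.trans hij.symm, hvj⟩, hvj.trans hjk⟩
  · rintro ⟨⟨hvi, hvj⟩, hvk⟩
    exact ⟨⟨Or.inl hvj, Or.inl (hvi.symm.trans hvj)⟩, hvj.symm.trans hvk⟩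

/-- The top cell does not depend on the order of the three marks other than `v`. -/
theorem pendantTopEvent_comm (v i j k : V) :
    G.pendantTopEvent v j i k = G.pendantTopEvent v i j k ∧
      G.pendantTopEvent v k i j = G.pendantTopEvent v i j k := by
  constructor
  · ext ω
    simp only [pendantTopEvent, Set.mem_inter_iff]
    tauto
  · ext ω
    simp only [pendantTopEvent, Set.mem_inter_iff]
    tauto

section Prob

variable [Fintype E] [DecidableEq E]

open Classical in
/-- **Lemma N**: `P(F ∩ J) ≤ P(F) · P(J)`.  Given the cluster `C` of `v`, the event `J = {j ↔ k}`
has conditional probability `P_{H − C}(j ↔ k) ≤ P_H(j ↔ k)` (the edges at `C` are switched off),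
and `F` is a function of `C` vanishing when `j ∈ C`. -/
theorem prob_pairEvent_inter_connEvent_le (v i j k : V) {p : E → ℝ} (hp : IsProb p) :
    prob p (G.pairEvent v i j k ∩ G.connEvent j k) ≤
      prob p (G.pairEvent v i j k) * prob p (G.connEvent j k) := by
  set Ψ : Set V → ℝ := fun W => if i ∈ W ∧ j ∉ W ∧ k ∉ W then 1 else 0 with hΨdef
  have hΨ0 : ∀ W, 0 ≤ Ψ W := fun W => by
    simp only [hΨdef]
    split_ifs <;> norm_num
  have hΨj : ∀ W, j ∈ W → Ψ W = 0 := fun W hW => by simp [hΨdef, hW]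
  have hF : (G.pairEvent v i j k).indicator (1 : Config E → ℝ) =
      fun ω => Ψ (G.cluster ω v) := by
    funext ω
    by_cases hω : ω ∈ G.pairEvent v i j k
    · rw [Set.indicator_of_mem hω]
      have h := (G.mem_pairEvent_iff v i j k ω).1 hω
      show (1 : ℝ) = if i ∈ G.cluster ω v ∧ j ∉ G.cluster ω v ∧ k ∉ G.cluster ω v then 1 else 0
      rw [if_pos h]
    · rw [Set.indicator_of_notMem hω]
      have h : ¬ (i ∈ G.cluster ω v ∧ j ∉ G.cluster ω v ∧ k ∉ G.cluster ω v) :=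
        fun h => hω ((G.mem_pairEvent_iff v i j k ω).2 h)
      show (0 : ℝ) = if i ∈ G.cluster ω v ∧ j ∉ G.cluster ω v ∧ k ∉ G.cluster ω v then 1 else 0
      rw [if_neg h]
  have e1 : prob p (G.pairEvent v i j k ∩ G.connEvent j k) =
      expect p (fun ω => Ψ (G.cluster ω v) * (G.connEvent j k).indicator 1 ω) := by
    rw [prob_eq_expect_indicator, Set.inter_indicator_one, hF]
    rfl
  rw [e1, G.expect_clusterFun_mul_indicator v j p (G.clusterDet_connEvent j k) Ψ hΨj]
  calc expect p (fun ω => Ψ (G.cluster ω v) *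
          prob (zeroOn p (G.touchingFinset (G.cluster ω v))) (G.connEvent j k))
      ≤ expect p (fun ω => Ψ (G.cluster ω v) * prob p (G.connEvent j k)) := by
        refine expect_mono hp fun ω => ?_
        refine mul_le_mul_of_nonneg_left ?_ (hΨ0 _)
        exact prob_mono_of_isUpperSet (isProb_zeroOn hp _) hp (zeroOn_le hp _)
          (G.isUpperSet_connEvent j k)
    _ = prob p (G.pairEvent v i j k) * prob p (G.connEvent j k) := by
        have h : (fun ω => Ψ (G.cluster ω v) * prob p (G.connEvent j k)) =
            fun ω => prob p (G.connEvent j k) * (G.pairEvent v i j k).indicator 1 ω := by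
          funext ω
          rw [hF]
          ring
        rw [h, expect_const_mul, expect_indicator_one, mul_comm]

/-- **Lemma 7₀** (Harris on the cells): `P(J) · P(Y) ≤ P(Jᶜ) · P(⊤)` with `Y = D ∩ Jᶜ` and
`⊤ = D ∩ J`; equivalently `P(D) · P(J) ≤ P(D ∩ J)`. -/
theorem harris_cells (v i j k : V) {p : E → ℝ} (hp : IsProb p) :
    prob p (G.connEvent j k) * prob p (G.attachEvent v i j k ∩ G.sepEvent j k) ≤
      prob p (G.sepEvent j k) * prob p (G.attachEvent v i j k ∩ G.connEvent j k) := by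
  have hH := harris hp (G.isUpperSet_attachEvent v i j k) (G.isUpperSet_connEvent j k)
  have hsplit := prob_inter_add_prob_inter_compl p (G.attachEvent v i j k) (G.connEvent j k)
  have hc : prob p (G.sepEvent j k) = 1 - prob p (G.connEvent j k) := prob_compl p _
  show prob p (G.connEvent j k) * prob p (G.attachEvent v i j k ∩ (G.connEvent j k)ᶜ) ≤
    prob p (G.sepEvent j k) * prob p (G.attachEvent v i j k ∩ G.connEvent j k)
  rw [hc]
  have hy : prob p (G.attachEvent v i j k ∩ (G.connEvent j k)ᶜ) =
      prob p (G.attachEvent v i j k) - prob p (G.attachEvent v i j k ∩ G.connEvent j k) := by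
    linarith
  rw [hy]
  nlinarith [hH]

/-- **Lemma 7**: for every `p' ≤ p` (for instance `p` switched off on the edges at a vertex set
`C`, so that `P_{p'}(j ↔ k) = P_{H − C}(j ↔ k)`) and `q = P_{p'}(j ↔ k)`:
`q · P(Y) ≤ (1 − q) · P(⊤)`. -/
theorem lemma7_of_le (v i j k : V) {p p' : E → ℝ} (hp : IsProb p) (hp' : IsProb p')
    (hle : p' ≤ p) :
    prob p' (G.connEvent j k) * prob p (G.attachEvent v i j k ∩ G.sepEvent j k) ≤
      (1 - prob p' (G.connEvent j k)) * prob p (G.attachEvent v i j k ∩ G.connEvent j k) := by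
  have hq := prob_mono_of_isUpperSet hp' hp hle (G.isUpperSet_connEvent j k)
  have h0 := G.harris_cells v i j k hp
  have hc : prob p (G.sepEvent j k) = 1 - prob p (G.connEvent j k) := prob_compl p _
  rw [hc] at h0
  have hY0 := prob_nonneg hp (G.attachEvent v i j k ∩ G.sepEvent j k)
  have hT0 := prob_nonneg hp (G.attachEvent v i j k ∩ G.connEvent j k)
  nlinarith [mul_le_mul_of_nonneg_right hq hY0, mul_le_mul_of_nonneg_right hq hT0]

/-- **Lemma 6, pendant form**: `x_i · P(Y) ≤ R_i · P(⊤)`, where `x_i = P(vi|jk) = P(F ∩ J)`,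
`R_i = P(vi|j|k) = P(F ∩ Jᶜ)`, `Y = D ∩ Jᶜ` (the cells `vik|j, vij|k, vj|ik, vk|ij`) and
`⊤ = D ∩ J`.  Proof: `x_i ≤ P(F) P(J)` (Lemma N), `P(⊤) ≥ P(D) P(J)` (Harris), and the two
complements. -/
theorem pendant_lemma6 (v i j k : V) {p : E → ℝ} (hp : IsProb p) :
    prob p (G.pairEvent v i j k ∩ G.connEvent j k) *
        prob p (G.attachEvent v i j k ∩ G.sepEvent j k) ≤
      prob p (G.pairEvent v i j k ∩ G.sepEvent j k) *
        prob p (G.attachEvent v i j k ∩ G.connEvent j k) := by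
  have hN := G.prob_pairEvent_inter_connEvent_le v i j k hp
  have hH := harris hp (G.isUpperSet_attachEvent v i j k) (G.isUpperSet_connEvent j k)
  have hF := prob_inter_add_prob_inter_compl p (G.pairEvent v i j k) (G.connEvent j k)
  have hD := prob_inter_add_prob_inter_compl p (G.attachEvent v i j k) (G.connEvent j k)
  have hf0 := prob_nonneg hp (G.pairEvent v i j k)
  have hd0 := prob_nonneg hp (G.attachEvent v i j k)
  show prob p (G.pairEvent v i j k ∩ G.connEvent j k) *
        prob p (G.attachEvent v i j k ∩ (G.connEvent j k)ᶜ) ≤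
      prob p (G.pairEvent v i j k ∩ (G.connEvent j k)ᶜ) *
        prob p (G.attachEvent v i j k ∩ G.connEvent j k)
  have hy : prob p (G.attachEvent v i j k ∩ (G.connEvent j k)ᶜ) =
      prob p (G.attachEvent v i j k) - prob p (G.attachEvent v i j k ∩ G.connEvent j k) := by
    linarith
  have hr : prob p (G.pairEvent v i j k ∩ (G.connEvent j k)ᶜ) =
      prob p (G.pairEvent v i j k) - prob p (G.pairEvent v i j k ∩ G.connEvent j k) := by
    linarith
  rw [hy, hr]
  nlinarith [mul_le_mul_of_nonneg_right hN hd0, mul_le_mul_of_nonneg_left hH hf0]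

/-- **(5a), summed form**: for marks `v b c d` with `v` distinguished,
`Σ_i x_i · P(Y_i) ≤ (R_b + R_c + R_d) · P(⊤)`, where `Y_i = W_j + W_k + x_j + x_k` in the
notation of `LEAD-C011-concavity.md` §10; this dominates (5a)
`e₂(x) + Σ_{i≠j} x_i W_j ≤ Σ_{i≠j} R_i x_j + R · top`, i.e. `Φ⁺` is concave along a pendant
mark-edge. -/
theorem pendant_5a_sum (v b c d : V) {p : E → ℝ} (hp : IsProb p) :
    prob p (G.pairEvent v b c d ∩ G.connEvent c d) *
          prob p (G.attachEvent v b c d ∩ G.sepEvent c d) +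
        prob p (G.pairEvent v c b d ∩ G.connEvent b d) *
          prob p (G.attachEvent v c b d ∩ G.sepEvent b d) +
        prob p (G.pairEvent v d b c ∩ G.connEvent b c) *
          prob p (G.attachEvent v d b c ∩ G.sepEvent b c) ≤
      (prob p (G.pairEvent v b c d ∩ G.sepEvent c d) +
          prob p (G.pairEvent v c b d ∩ G.sepEvent b d) +
          prob p (G.pairEvent v d b c ∩ G.sepEvent b c)) *
        prob p (G.pendantTopEvent v b c d) := by
  have h1 := G.pendant_lemma6 v b c d hp
  have h2 := G.pendant_lemma6 v c b d hp
  have h3 := G.pendant_lemma6 v d b c hp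
  rw [G.attachEvent_inter_connEvent] at h1 h2 h3
  rw [(G.pendantTopEvent_comm v b c d).1] at h2
  rw [(G.pendantTopEvent_comm v b c d).2] at h3
  linarith

end Prob

end MultiGraph

end PercRepro
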